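/-
Copyright: lit-balaban cell (HOME `run/shared/lean/pub/lit-balaban/`), Phase-2 proof seat p12 (gen 15).  Statement-level record of
a published text; nothing is claimed beyond what the kernel checks below.
-/
import Literature.MathematicalPhysics.QuantumFieldTheory.FariaDaVeigaOCarroll2022.FdVOC22GeneratingFunctionBound
import HarnessLib

/-!
# `FariaDaVeigaOCarroll2022.FdVOC22ThermodynamicLimitBound` — P. A. Faria da Veiga, M. O'Carroll, *On Yang–Mills stability
# bounds and plaquette field generating function*, arXiv:2205.07376 (Rep. Math. Phys. **95** (2025) 303–380)
# [FariaDaVeigaOCarroll2022YMStability]: **THEOREM 4, second item** — the bound on any (sub)sequential THERMODYNAMIC LIMIT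
# of the `r`-plaquette generating function, `|G_{r,a}(J^{(r)})| ≤ ∏_j |z_u(rJ_j)/z_ℓ|^{2^d(d−1)/r}`, PROVED from the first item
# (`FdVOC22GeneratingFunctionBound.theorem4_generating_function_bound_printed`) by the exponent count `Λ_r/Λ_s → d − 1`,
# `(Λ_r + Λ_e)/Λ_s → d − 1`

statement-level skeleton of published theorems with citation tags; proofs where landed; nothing here is a claim about
the Yang–Mills mass gap

Source held: `paper:arxiv-2205.07376` (corpus-tex layer; page = chunk `pNNNN`, `L` = line).  Unit `lit-balaban-p12` (gen 15),
free-target protocol G.5-34(d); context row X2 of the cell's `YM-INPRINT.md` (register level, bears on no verdict there).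

WHAT IS PRINTED (Theorem 4, chunk p0016 L46–52). First item (Gb): «`|G_{r,Λ,a}(J^{(r)})| ≤ ∏_{1≤j≤r} |z_u(rJ_j)|^{2^dΛ_r/(rΛ_s)}
z_ℓ^{2^d(Λ_r+Λ_e)/(rΛ_s)}`» (the tree's `theorem4_generating_function_bound_printed`, with the negative exponent on `z_ℓ ≤ 1`).
Second item: «From this, if `G_{r,a}(J^{(r)})` denotes a sequential or subsequential thermodynamic limit `Λ → aℤ^d`, then
`|G_{r,a}(J^{(r)})| ≤ ∏_{1≤j≤r} |z_u(rJ_j)/z_ℓ|^{2^d(d−1)/r}`.»  The count behind it (§2, chunk p0007): `Λ_s = L^d` sites,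
`Λ_r` retained bonds, `Λ_e = dL^{d−1}` extra (closing) bonds, «the number of non-gauged away bond variables is then `Λ_r + Λ_e`»
— in the tree `card_freeEdges_add_closing`: `Λ_r + dL^{d−1} = dL^d − (L^d − 1)`.

WHAT IS PROVED HERE (zero `sorry`, zero named facts).
* `expR`, `expRE`: the two finite-volume exponents of (Gb) as functions of `L` (definitionally those of
  `theorem4_generating_function_bound_printed` at `L = 2M`); `limExponent d r = 2^d(d−1)/r`.
* `expRE_eq`, `expR_eq`: closed forms `(2^d/r)(d − 1 + L^{−d})` and `(2^d/r)(d − 1 + L^{−d} − d/L)`; `tendsto_expRE`,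
  `tendsto_expR`: both tend to `2^d(d−1)/r` along any `L_n → ∞`.
* **`theorem4_thermodynamic_limit`**: for `U(N)`, `d ≥ 2`, `β ≥ 0`, any `r`, source strengths `J`, ANY sequence of volumes
  `L_n = 2M_n` with `M_n` even and `M_n → ∞`, ANY placements `p^{(n)}` of the `r` plaquettes in `Λ_n`, and any limit `G` of
  `G_{r,Λ_n,a}(J^{(r)})`: `‖G‖ ≤ ∏_j (|z_u(r|J_j|)|/z_ℓ)^{2^d(d−1)/r}`; `theorem4_thermodynamic_limit_clusterPt`: the same for
  every cluster point of the sequence (= «sequential or subsequential limit»).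

READINGS (declared). (i) As in the gen-13/14 files the print's «`L` even» is `L = 2M`, `M` even (the block-2 reflection array);
the thermodynamic limit is along such `L`. (ii) `z_u(rJ_j)` enters through `zuJ N β (r‖J_j‖)` (the first line of (Gb2), a
function of `|J|`), `z_ℓ` is the tree's Frobenius-currency `zl` (`0 < z_ℓ ≤ 1`). (iii) Existence of the limit is not
asserted by the print («sequential or subsequential») nor here: the bound holds for whatever limit point is given.

NOT CLAIMED. The third item of Theorem 4 (continuum limit `a ↘ 0` with the constants `c′_u`, `c_ℓ` of (Gb2) lines 2–4 and
Theorem 2 — these need the Weyl integration formula on `U(N)`, not in the tree); any statement about a mass gap or about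
Bałaban's papers.
-/

noncomputable section

open scoped ENNReal Topology
open MeasureTheory Finset Filter
open Literature.Probability.LatticeModels Literature.MathematicalPhysics.QuantumLattice

namespace Literature.MathematicalPhysics.QuantumFieldTheory

namespace FariaDaVeigaOCarroll2022

open AxialGauge

variable {d N : ℕ}

section Exponents

/-- The exponent of `|z_u(rJ_j)|` in (Gb): `2^dΛ_r/(rΛ_s)` with `Λ_r = #(freeEdges d L)`, `Λ_s = L^d`.
[cite: FariaDaVeigaOCarroll2022YMStability, Theorem 4 (Gb) (chunk p0016)] -/
def expR (d r L : ℕ) : ℝ := (2 : ℝ) ^ d * (#(freeEdges d L) : ℝ) / (r * (L : ℝ) ^ d)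

/-- The exponent of `z_ℓ` in (Gb): `2^d(Λ_r + Λ_e)/(rΛ_s)` with `Λ_r + Λ_e = dL^d − (L^d − 1)`.
[cite: FariaDaVeigaOCarroll2022YMStability, Theorem 4 (Gb) (chunk p0016)] -/
def expRE (d r L : ℕ) : ℝ := (2 : ℝ) ^ d * ((d * L ^ d - (L ^ d - 1) : ℕ) : ℝ) / (r * (L : ℝ) ^ d)

/-- The limit exponent `2^d(d−1)/r` of Theorem 4, second item.
[cite: FariaDaVeigaOCarroll2022YMStability, Theorem 4 second item (chunk p0016)] -/
def limExponent (d r : ℕ) : ℝ := (2 : ℝ) ^ d * ((d : ℝ) - 1) / r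

/-- `2^d(Λ_r+Λ_e)/(rΛ_s) = (2^d/r)(d − 1 + L^{−d})` for `d, L ≥ 1`.
[cite: FariaDaVeigaOCarroll2022YMStability, §2 «Λ_r + Λ_e» (chunk p0007)] -/
theorem expRE_eq (hd : 1 ≤ d) {r L : ℕ} (hL : 1 ≤ L) :
    expRE d r L = (2 : ℝ) ^ d / r * ((d : ℝ) - 1 + ((L : ℝ) ^ d)⁻¹) := by
  unfold expRE
  have hLd : 1 ≤ L ^ d := Nat.one_le_pow _ _ hL
  have hle : L ^ d - 1 ≤ d * L ^ d := le_trans (Nat.sub_le _ _) (Nat.le_mul_of_pos_left _ hd)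
  have hcast : ((d * L ^ d - (L ^ d - 1) : ℕ) : ℝ) = (d : ℝ) * (L : ℝ) ^ d - ((L : ℝ) ^ d - 1) := by
    rw [Nat.cast_sub hle, Nat.cast_sub hLd]
    push_cast
    ring
  rw [hcast]
  have hL0 : (L : ℝ) ^ d ≠ 0 := pow_ne_zero _ (by exact_mod_cast (show L ≠ 0 by omega))
  rcases Nat.eq_zero_or_pos r with hr | hr
  · subst hr; simp
  · have hr0 : (r : ℝ) ≠ 0 := by exact_mod_cast hr.ne'
    field_simp
    ring

/-- `2^dΛ_r/(rΛ_s) = (2^d/r)(d − 1 + L^{−d} − d/L)` for `d, L ≥ 1` (from `Λ_r = dL^d − (L^d − 1) − dL^{d−1}`).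
[cite: FariaDaVeigaOCarroll2022YMStability, §2 «Λ_r + Λ_e» (chunk p0007)] -/
theorem expR_eq (hd : 1 ≤ d) {r L : ℕ} (hL : 1 ≤ L) :
    expR d r L = (2 : ℝ) ^ d / r * ((d : ℝ) - 1 + ((L : ℝ) ^ d)⁻¹ - d * (L : ℝ)⁻¹) := by
  unfold expR
  have h := card_freeEdges_add_closing (d := d) (L := L) hd hL
  have hLd : 1 ≤ L ^ d := Nat.one_le_pow _ _ hL
  have hle : L ^ d - 1 ≤ d * L ^ d := le_trans (Nat.sub_le _ _) (Nat.le_mul_of_pos_left _ hd)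
  have hcard : (#(freeEdges d L) : ℝ) = (d : ℝ) * (L : ℝ) ^ d - ((L : ℝ) ^ d - 1) - d * (L : ℝ) ^ (d - 1) := by
    have h' : ((#(freeEdges d L) + d * L ^ (d - 1) : ℕ) : ℝ) = ((d * L ^ d - (L ^ d - 1) : ℕ) : ℝ) := by
      exact_mod_cast h
    rw [Nat.cast_sub hle, Nat.cast_sub hLd] at h'
    push_cast at h'
    linarith
  rw [hcard]
  have hL0' : (L : ℝ) ≠ 0 := by exact_mod_cast (show L ≠ 0 by omega)
  have hL0 : (L : ℝ) ^ d ≠ 0 := pow_ne_zero _ hL0'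
  have hpow : (L : ℝ) ^ d = (L : ℝ) * (L : ℝ) ^ (d - 1) := by
    rw [← pow_succ']; congr 1; omega
  rcases Nat.eq_zero_or_pos r with hr | hr
  · subst hr; simp
  · have hr0 : (r : ℝ) ≠ 0 := by exact_mod_cast hr.ne'
    field_simp
    rw [hpow]
    ring

/-- `2^d(Λ_r+Λ_e)/(rΛ_s) → 2^d(d−1)/r` along any `L_n → ∞`.
[cite: FariaDaVeigaOCarroll2022YMStability, Theorem 4 second item (chunk p0016)] -/
theorem tendsto_expRE (hd : 1 ≤ d) (r : ℕ) {L : ℕ → ℕ} (hL : Tendsto L atTop atTop) :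
    Tendsto (fun n => expRE d r (L n)) atTop (𝓝 (limExponent d r)) := by
  have hLr : Tendsto (fun n => (L n : ℝ)) atTop atTop := tendsto_natCast_atTop_atTop.comp hL
  have hinv : Tendsto (fun n => ((L n : ℝ) ^ d)⁻¹) atTop (𝓝 0) :=
    tendsto_inv_atTop_zero.comp ((tendsto_pow_atTop (by omega)).comp hLr)
  have hev : ∀ᶠ n in atTop, expRE d r (L n) = (2 : ℝ) ^ d / r * ((d : ℝ) - 1 + ((L n : ℝ) ^ d)⁻¹) := by
    filter_upwards [hL.eventually_ge_atTop 1] with n hn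
    exact expRE_eq hd hn
  rw [tendsto_congr' hev]
  have : limExponent d r = (2 : ℝ) ^ d / r * ((d : ℝ) - 1 + 0) := by
    unfold limExponent; ring
  rw [this]
  exact tendsto_const_nhds.mul (tendsto_const_nhds.add hinv)

/-- `2^dΛ_r/(rΛ_s) → 2^d(d−1)/r` along any `L_n → ∞`.
[cite: FariaDaVeigaOCarroll2022YMStability, Theorem 4 second item (chunk p0016)] -/
theorem tendsto_expR (hd : 1 ≤ d) (r : ℕ) {L : ℕ → ℕ} (hL : Tendsto L atTop atTop) :
    Tendsto (fun n => expR d r (L n)) atTop (𝓝 (limExponent d r)) := by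
  have hLr : Tendsto (fun n => (L n : ℝ)) atTop atTop := tendsto_natCast_atTop_atTop.comp hL
  have hinv : Tendsto (fun n => ((L n : ℝ) ^ d)⁻¹) atTop (𝓝 0) :=
    tendsto_inv_atTop_zero.comp ((tendsto_pow_atTop (by omega)).comp hLr)
  have hinv1 : Tendsto (fun n => (d : ℝ) * (L n : ℝ)⁻¹) atTop (𝓝 0) := by
    simpa using tendsto_const_nhds.mul (tendsto_inv_atTop_zero.comp hLr)
  have hev : ∀ᶠ n in atTop, expR d r (L n) =
      (2 : ℝ) ^ d / r * ((d : ℝ) - 1 + ((L n : ℝ) ^ d)⁻¹ - d * (L n : ℝ)⁻¹) := by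
    filter_upwards [hL.eventually_ge_atTop 1] with n hn
    exact expR_eq hd hn
  rw [tendsto_congr' hev]
  have : limExponent d r = (2 : ℝ) ^ d / r * ((d : ℝ) - 1 + 0 - 0) := by
    unfold limExponent; ring
  rw [this]
  exact tendsto_const_nhds.mul ((tendsto_const_nhds.add hinv).sub hinv1)

/-- `2^d(d−1)/r > 0` for `d ≥ 2`, `r ≥ 1`. [cite: FariaDaVeigaOCarroll2022YMStability, Theorem 4 second item (chunk p0016)] -/
theorem limExponent_pos (hd : 2 ≤ d) {r : ℕ} (hr : 0 < r) : 0 < limExponent d r := by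
  unfold limExponent
  have : (1 : ℝ) < d := by exact_mod_cast hd
  have hr' : (0 : ℝ) < r := by exact_mod_cast hr
  have h2 : (0 : ℝ) < (2 : ℝ) ^ d := by positivity
  exact div_pos (mul_pos h2 (by linarith)) hr'

end Exponents

section Limit

/-- **THEOREM 4, second item** [FariaDaVeigaOCarroll2022YMStability] (chunk p0016 L50–52): «if `G_{r,a}(J^{(r)})` denotes a
sequential or subsequential thermodynamic limit `Λ → aℤ^d`, then `|G_{r,a}(J^{(r)})| ≤ ∏_{1≤j≤r} |z_u(rJ_j)/z_ℓ|^{2^d(d−1)/r}`»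
— for `U(N)`, `d ≥ 2`, `β ≥ 0`: along ANY sequence of volumes `L_n = 2M_n` (`M_n` even, `M_n → ∞`), ANY plaquette
placements `p^{(n)}` and source strengths `J`, every limit `G` of `G_{r,Λ_n,a}(J^{(r)})` obeys the bound (a subsequential
limit is this statement applied to the subsequence). [cite: FariaDaVeigaOCarroll2022YMStability, Theorem 4 second item (chunk p0016)] -/
theorem theorem4_thermodynamic_limit [NeZero d] (hd : 2 ≤ d) {β : ℝ} (hβ : 0 ≤ β) {r : ℕ} (J : Fin r → ℂ)
    (M : ℕ → ℕ) [hM0 : ∀ n, NeZero (M n)] (hMe : ∀ n, Even (M n)) (hM : Tendsto M atTop atTop)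
    (p : ∀ n, Fin r → Plaquette d (2 * M n)) {G : ℂ}
    (hG : Tendsto (fun n => genFun N β (p n) J) atTop (𝓝 G)) :
    ‖G‖ ≤ ∏ j, ((zuJ N β (r * ‖J j‖)).toReal / (zl d N β).toReal) ^ limExponent d r := by
  have hb : ∀ n, ‖genFun N β (p n) J‖ ≤ ∏ j, (zuJ N β (r * ‖J j‖)).toReal ^ expR d r (2 * M n) *
      (zl d N β).toReal ^ (-(expRE d r (2 * M n))) := fun n =>
    theorem4_generating_function_bound_printed (N := N) hd (hMe n) hβ (p n) J
  have hx : ∀ j, 0 ≤ (zuJ N β (r * ‖J j‖)).toReal := fun j => ENNReal.toReal_nonneg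
  have hy : 0 < (zl d N β).toReal :=
    ENNReal.toReal_pos (zl_pos hβ).ne' ((zl_le_one hβ).trans_lt ENNReal.one_lt_top).ne
  rcases Nat.eq_zero_or_pos r with hr | hr
  · subst hr
    have h1 : ∀ n, ‖genFun N β (p n) J‖ ≤ 1 := fun n => by simpa using hb n
    have : ‖G‖ ≤ 1 := le_of_tendsto' (hG.norm) h1
    simpa using this
  have hL : Tendsto (fun n => 2 * M n) atTop atTop :=
    Filter.tendsto_id.const_mul_atTop' (by norm_num : 0 < 2) |>.comp hM
  have hd1 : 1 ≤ d := le_trans (by norm_num) hd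
  have he1 : Tendsto (fun n => expR d r (2 * M n)) atTop (𝓝 (limExponent d r)) := tendsto_expR hd1 r hL
  have he2 : Tendsto (fun n => -(expRE d r (2 * M n))) atTop (𝓝 (-(limExponent d r))) :=
    (tendsto_expRE hd1 r hL).neg
  have hne : limExponent d r ≠ 0 := (limExponent_pos hd hr).ne'
  have hfac : ∀ j, Tendsto (fun n => (zuJ N β (r * ‖J j‖)).toReal ^ expR d r (2 * M n) *
      (zl d N β).toReal ^ (-(expRE d r (2 * M n)))) atTop
      (𝓝 ((zuJ N β (r * ‖J j‖)).toReal ^ limExponent d r * (zl d N β).toReal ^ (-(limExponent d r)))) :=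
    fun j => ((Real.continuousAt_const_rpow' hne).tendsto.comp he1).mul
      ((Real.continuousAt_const_rpow' (neg_ne_zero.mpr hne)).tendsto.comp he2)
  have hprod := tendsto_finsetProd (Finset.univ : Finset (Fin r)) (fun j _ => hfac j)
  have hle := le_of_tendsto_of_tendsto' hG.norm hprod hb
  refine hle.trans (le_of_eq (Finset.prod_congr rfl fun j _ => ?_))
  rw [Real.rpow_neg hy.le, Real.div_rpow (hx j) hy.le, div_eq_mul_inv]

/-- The same for EVERY CLUSTER POINT of the sequence `G_{r,Λ_n,a}(J^{(r)})` — the print's «sequential or subsequential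
thermodynamic limit». [cite: FariaDaVeigaOCarroll2022YMStability, Theorem 4 second item (chunk p0016)] -/
theorem theorem4_thermodynamic_limit_clusterPt [NeZero d] (hd : 2 ≤ d) {β : ℝ} (hβ : 0 ≤ β) {r : ℕ} (J : Fin r → ℂ)
    (M : ℕ → ℕ) [hM0 : ∀ n, NeZero (M n)] (hMe : ∀ n, Even (M n)) (hM : Tendsto M atTop atTop)
    (p : ∀ n, Fin r → Plaquette d (2 * M n)) {G : ℂ}
    (hG : MapClusterPt G atTop (fun n => genFun N β (p n) J)) :
    ‖G‖ ≤ ∏ j, ((zuJ N β (r * ‖J j‖)).toReal / (zl d N β).toReal) ^ limExponent d r := by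
  obtain ⟨φ, hφ, hlim⟩ := hG.tendsto_subseq
  haveI : ∀ n, NeZero (M (φ n)) := fun n => hM0 (φ n)
  exact theorem4_thermodynamic_limit (N := N) hd hβ J (fun n => M (φ n)) (fun n => hMe (φ n))
    (hM.comp hφ.tendsto_atTop) (fun n => p (φ n)) hlim

end Limit

end FariaDaVeigaOCarroll2022

end Literature.MathematicalPhysics.QuantumFieldTheory
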